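import Literature.Analysis.ValidatedNumerics.QuadCertPoly
import HarnessLib

/-!
# Degree-two Positivstellensatz certificate trees and their checker (`QuadCert`, part 2)

Topic `Literature/Analysis/ValidatedNumerics`.  A CONTEXT is a finite list of quadratic polynomial facts
`gᵢ(x) ≥ 0` and AFFINE facts `hⱼ(x) = 0` about an unknown point `x : ℕ → ℝ`.  A STEP derives a new fact
`f ≥ 0` from an explicit identity (checked by `QPoly.isZero` in exact rational arithmetic)

  `f = Σ λᵢ gᵢ + Σ μⱼ hⱼ + Σ κ_ab gₐ g_b + Σ d_m ℓ_m² + c`,  `λ, κ, d, c ≥ 0`, `μⱼ, gₐ, g_b, ℓ_m` affine,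

the order-one Lasserre / Shor relaxation in certificate form [cite: Lasserre2001, Thm 4.2]; with the products
`gₐ g_b` of affine facts it also covers linear-programming duality with interval remainders and McCormick /
reformulation–linearisation cuts.  A TREE chains steps, divides by a provably positive affine fact (`div`:
from `(gₐ + c)·f ≥ 0`, `c > 0`, `gₐ ≥ 0` conclude `f ≥ 0`), SPLITS on the sign of an affine polynomial (both
branches must close), and closes a branch either by a contradiction (`contra`: a negative constant is `≥ 0`)
or by a GOAL leaf naming, by index, context facts equal to the goal polynomials of a user-supplied goal
specification.  `Tree.check` is the Boolean checker; **`Tree.sound`**: if it accepts, every real point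
satisfying the root context satisfies some well-formed goal specification of the tree.  The goal
specifications are abstract (`γ`, read through `gp : γ → Option (List QPoly)`), so the same checker serves any
problem whose hypotheses and conclusions are quadratic in finitely many real unknowns (the tree's first user:
tolerant rigidity of the fcc / hcp kissing shells, `Summits/AtomisticToContinuum/Crystallization`).

Design: contexts are `Array`s (constant-time fact lookup by index; certificates refer to facts by position);
everything is computable and structurally recursive, meant for `native_decide` (the zero test sorts
terms with `List.mergeSort`, which the kernel does not reduce; realistic trees arrive as decoded text,
`QuadCertText.lean`).  No analysis, no facts, no axioms.

## References
* J. B. Lasserre, SIAM J. Optim. 11 (2001), Thm 4.2. [cite: Lasserre2001, Thm 4.2]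
* R. E. Moore, *Interval Analysis* (1966), §4.4 (exclusion / subdivision — the `split` rule). [cite: Moore1966, §4.4]
-/

namespace Literature.Analysis.ValidatedNumerics

open QPoly

namespace QuadCert

/-! ### Contexts -/

/-- A context: quadratic facts `≥ 0` and affine facts `= 0`. [folklore] -/
structure Ctx where
  /-- facts `g(x) ≥ 0` -/
  ineqs : Array QPoly
  /-- facts `h(x) = 0` -/
  eqs : Array QPoly

namespace Ctx

/-- The point `x` satisfies every fact of the context. [folklore] -/
def Holds (Γ : Ctx) (x : ℕ → ℝ) : Prop :=
  (∀ g ∈ Γ.ineqs, 0 ≤ g.eval x) ∧ (∀ h ∈ Γ.eqs, h.eval x = 0)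

/-- Add an inequality fact. [folklore] -/
def push (Γ : Ctx) (g : QPoly) : Ctx := ⟨Γ.ineqs.push g, Γ.eqs⟩

/-- `push` preserves `Holds` when the new fact holds. [folklore] -/
theorem holds_push {Γ : Ctx} {x : ℕ → ℝ} (hΓ : Γ.Holds x) {g : QPoly} (hg : 0 ≤ g.eval x) :
    (Γ.push g).Holds x := by
  refine ⟨fun g' hg' => ?_, hΓ.2⟩
  rcases Array.mem_push.mp hg' with h | h
  · exact hΓ.1 g' h
  · exact h ▸ hg

/-- A fact looked up by index holds. [folklore] -/
theorem ineq_nonneg {Γ : Ctx} {x : ℕ → ℝ} (hΓ : Γ.Holds x) {i : ℕ} {g : QPoly} (h : Γ.ineqs[i]? = some g) :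
    0 ≤ g.eval x :=
  hΓ.1 g (Array.mem_of_getElem? h)

/-- An equation looked up by index holds. [folklore] -/
theorem eq_zero {Γ : Ctx} {x : ℕ → ℝ} (hΓ : Γ.Holds x) {j : ℕ} {h : QPoly} (hh : Γ.eqs[j]? = some h) :
    h.eval x = 0 :=
  hΓ.2 h (Array.mem_of_getElem? hh)

end Ctx

/-! ### Steps -/

/-- One certificate step: the claimed fact `target ≥ 0` and the multipliers of the identity
`target = Σ λᵢ·ineqs[i] + Σ μⱼ·eqs[j] + Σ κ·ineqs[a]·ineqs[b] + Σ d·ℓ² + cst`. [cite: Lasserre2001, Thm 4.2] -/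
structure Step where
  /-- the new fact -/
  target : QPoly
  /-- `(i, λᵢ)` with `λᵢ ≥ 0` -/
  lam : List (ℕ × ℚ) := []
  /-- `(j, μⱼ)` with `μⱼ` affine (and `eqs[j]` affine) -/
  mu : List (ℕ × QPoly) := []
  /-- `(a, b, κ)` with `κ ≥ 0`, `ineqs[a]`, `ineqs[b]` affine -/
  prods : List (ℕ × ℕ × ℚ) := []
  /-- `(d, ℓ)` with `d ≥ 0`, `ℓ` affine -/
  sos : List (ℚ × QPoly) := []
  /-- nonnegative constant -/
  cst : ℚ := 0

/-- `Σ λᵢ · A[i]` if all indices are in range and all `λᵢ ≥ 0`. [folklore] -/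
def lamPart (A : Array QPoly) : List (ℕ × ℚ) → Option QPoly
  | [] => some (const 0)
  | (i, a) :: l =>
    match A[i]?, lamPart A l with
    | some g, some r => if 0 ≤ a then some (add (smul a g) r) else none
    | _, _ => none

/-- `Σ μⱼ · E[j]` if indices are in range and `μⱼ`, `E[j]` are affine. [folklore] -/
def muPart (E : Array QPoly) : List (ℕ × QPoly) → Option QPoly
  | [] => some (const 0)
  | (j, m) :: l =>
    match E[j]?, muPart E l with
    | some h, some r => if m.isAff && h.isAff then some (add (mulAff m h) r) else none
    | _, _ => none

/-- `Σ κ · A[a] · A[b]` if indices are in range, `κ ≥ 0` and both facts are affine. [folklore] -/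
def prodPart (A : Array QPoly) : List (ℕ × ℕ × ℚ) → Option QPoly
  | [] => some (const 0)
  | (a, b, k) :: l =>
    match A[a]?, A[b]?, prodPart A l with
    | some g, some g', some r =>
      if 0 ≤ k ∧ g.isAff = true ∧ g'.isAff = true then some (add (smul k (mulAff g g')) r) else none
    | _, _, _ => none

/-- `Σ d · ℓ²` if all `d ≥ 0` and all `ℓ` affine. [folklore] -/
def sosPart : List (ℚ × QPoly) → Option QPoly
  | [] => some (const 0)
  | (d, l) :: rest =>
    match sosPart rest with
    | some r => if 0 ≤ d ∧ l.isAff = true then some (add (smul d (sqAff l)) r) else none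
    | none => none

/-- The right-hand side of a step, if well formed. [folklore] -/
def Step.rhs (Γ : Ctx) (s : Step) : Option QPoly :=
  match lamPart Γ.ineqs s.lam, muPart Γ.eqs s.mu, prodPart Γ.ineqs s.prods, sosPart s.sos with
  | some p₁, some p₂, some p₃, some p₄ =>
    if 0 ≤ s.cst then some (add p₁ (add p₂ (add p₃ (add p₄ (const s.cst))))) else none
  | _, _, _, _ => none

/-- A step is accepted when its identity holds exactly. [folklore] -/
def Step.ok (Γ : Ctx) (s : Step) : Bool :=
  match s.rhs Γ with
  | some r => (sub s.target r).isZero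
  | none => false

section Soundness

variable {x : ℕ → ℝ}

/-- `lamPart` is nonnegative on the context. [folklore] -/
theorem lamPart_nonneg {A : Array QPoly} (hA : ∀ g ∈ A, 0 ≤ g.eval x) :
    ∀ (l : List (ℕ × ℚ)) {r : QPoly}, lamPart A l = some r → 0 ≤ r.eval x
  | [], r, h => by simp [lamPart] at h; subst h; simp
  | (i, a) :: l, r, h => by
    simp only [lamPart] at h
    split at h
    · rename_i g r' hg hr'
      split_ifs at h with ha
      cases h
      rw [eval_add, eval_smul]
      have := lamPart_nonneg hA l hr'
      have := hA g (Array.mem_of_getElem? hg)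
      have : (0 : ℝ) ≤ a := by exact_mod_cast ha
      positivity
    · cases h

/-- `muPart` vanishes on the context. [folklore] -/
theorem muPart_eq_zero {E : Array QPoly} (hE : ∀ h ∈ E, h.eval x = 0) :
    ∀ (l : List (ℕ × QPoly)) {r : QPoly}, muPart E l = some r → r.eval x = 0
  | [], r, h => by simp [muPart] at h; subst h; simp
  | (j, m) :: l, r, h => by
    simp only [muPart] at h
    split at h
    · rename_i h' r' hh hr'
      split_ifs at h with hc
      cases h
      simp only [Bool.and_eq_true] at hc
      rw [eval_add, eval_mulAff x hc.1 hc.2, hE h' (Array.mem_of_getElem? hh), muPart_eq_zero hE l hr']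
      simp
    · cases h

/-- `prodPart` is nonnegative on the context. [folklore] -/
theorem prodPart_nonneg {A : Array QPoly} (hA : ∀ g ∈ A, 0 ≤ g.eval x) :
    ∀ (l : List (ℕ × ℕ × ℚ)) {r : QPoly}, prodPart A l = some r → 0 ≤ r.eval x
  | [], r, h => by simp [prodPart] at h; subst h; simp
  | (a, b, k) :: l, r, h => by
    simp only [prodPart] at h
    split at h
    · rename_i g g' r' hg hg' hr'
      split_ifs at h with hc
      cases h
      rw [eval_add, eval_smul, eval_mulAff x hc.2.1 hc.2.2]
      have := prodPart_nonneg hA l hr'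
      have := hA g (Array.mem_of_getElem? hg)
      have := hA g' (Array.mem_of_getElem? hg')
      have : (0 : ℝ) ≤ k := by exact_mod_cast hc.1
      positivity
    · cases h

/-- `sosPart` is nonnegative. [folklore] -/
theorem sosPart_nonneg : ∀ (l : List (ℚ × QPoly)) {r : QPoly}, sosPart l = some r → 0 ≤ r.eval x
  | [], r, h => by simp [sosPart] at h; subst h; simp
  | (d, p) :: l, r, h => by
    simp only [sosPart] at h
    split at h
    · rename_i r' hr'
      split_ifs at h with hc
      cases h
      rw [eval_add, eval_smul]
      have := sosPart_nonneg l hr'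
      have := eval_sqAff_nonneg x hc.2
      have : (0 : ℝ) ≤ d := by exact_mod_cast hc.1
      positivity
    · cases h

/-- **Soundness of a step**: an accepted step's target is nonnegative on the context. [cite: Lasserre2001, Thm 4.2] -/
theorem Step.sound {Γ : Ctx} {s : Step} (hs : s.ok Γ = true) (hΓ : Γ.Holds x) : 0 ≤ s.target.eval x := by
  unfold Step.ok at hs
  split at hs
  · rename_i r hr
    rw [eval_eq_of_isZero_sub hs x]
    unfold Step.rhs at hr
    split at hr
    · rename_i p₁ p₂ p₃ p₄ h₁ h₂ h₃ h₄
      split_ifs at hr with hc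
      cases hr
      simp only [eval_add, eval_const]
      have := lamPart_nonneg hΓ.1 _ h₁
      have := muPart_eq_zero hΓ.2 _ h₂
      have := prodPart_nonneg hΓ.1 _ h₃
      have := sosPart_nonneg (x := x) _ h₄
      have : (0 : ℝ) ≤ s.cst := by exact_mod_cast hc
      linarith
    · cases hr
  · cases hs

end Soundness

/-! ### Trees -/

/-- Certificate trees over goal specifications of type `γ`. [folklore] -/
inductive Tree (γ : Type) where
  /-- derive `s.target ≥ 0`, continue -/
  | step (s : Step) (t : Tree γ)
  /-- `s` certifies `(ineqs[a] + c) · f ≥ 0` with `c > 0`; conclude `f ≥ 0`, continue -/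
  | div (a : ℕ) (c : ℚ) (f : QPoly) (s : Step) (t : Tree γ)
  /-- case split on the sign of the affine `ℓ` -/
  | split (ℓ : QPoly) (pos neg : Tree γ)
  /-- `s` certifies that a negative constant is `≥ 0`: the branch is empty -/
  | contra (s : Step)
  /-- the goal polynomials of `spec` are the context facts at positions `idx` -/
  | goal (spec : γ) (idx : List ℕ)

namespace Tree

variable {γ : Type}

/-- All goal polynomials are found (up to `isZero` of the difference) at the given indices. [folklore] -/
def goalsFound (A : Array QPoly) : List QPoly → List ℕ → Bool
  | [], [] => true
  | q :: qs, i :: is =>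
    (match A[i]? with
      | some r => (sub q r).isZero
      | none => false) && goalsFound A qs is
  | _, _ => false

/-- **The checker.** `gp spec = none` marks an ill-formed goal specification. [folklore] -/
def check (gp : γ → Option (List QPoly)) : Ctx → Tree γ → Bool
  | Γ, step s t => s.ok Γ && check gp (Γ.push s.target) t
  | Γ, div a c f s t =>
    (match Γ.ineqs[a]? with
      | some g =>
        decide (0 < c) && g.isAff && f.isAff && (sub s.target (mulAff (add g (const c)) f)).isZero && s.ok Γ
      | none => false) &&
      check gp (Γ.push f) t
  | Γ, split ℓ l r => check gp (Γ.push ℓ) l && check gp (Γ.push (neg ℓ)) r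
  | Γ, contra s => s.ok Γ && s.target.lin.isEmpty && s.target.quad.isEmpty && decide (s.target.c < 0)
  | Γ, goal spec idx =>
    match gp spec with
    | some qs => goalsFound Γ.ineqs qs idx
    | none => false

variable {x : ℕ → ℝ}

/-- Found goals hold. [folklore] -/
theorem goalsFound_sound {A : Array QPoly} (hA : ∀ g ∈ A, 0 ≤ g.eval x) :
    ∀ (qs : List QPoly) (is : List ℕ), goalsFound A qs is = true → ∀ q ∈ qs, 0 ≤ q.eval x
  | [], [], _ => by simp
  | q :: qs, i :: is, h => by
    simp only [goalsFound, Bool.and_eq_true] at h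
    obtain ⟨h1, h2⟩ := h
    split at h1
    · rename_i r hr
      intro q' hq'
      rcases List.mem_cons.mp hq' with rfl | hq'
      · rw [eval_eq_of_isZero_sub h1 x]; exact hA r (Array.mem_of_getElem? hr)
      · exact goalsFound_sound hA qs is h2 q' hq'
    · cases h1
  | [], _ :: _, h => by simp [goalsFound] at h
  | _ :: _, [], h => by simp [goalsFound] at h

/-- **Soundness of the checker**: if a tree is accepted on a context, every point satisfying the context
satisfies all goal polynomials of some well-formed goal specification occurring in the tree.
[cite: Lasserre2001, Thm 4.2] -/
theorem sound (gp : γ → Option (List QPoly)) :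
    ∀ (t : Tree γ) (Γ : Ctx), check gp Γ t = true → Γ.Holds x →
      ∃ (spec : γ) (qs : List QPoly), gp spec = some qs ∧ ∀ q ∈ qs, 0 ≤ q.eval x
  | step s t, Γ, h, hΓ => by
    simp only [check, Bool.and_eq_true] at h
    exact sound gp t _ h.2 (Ctx.holds_push hΓ (Step.sound h.1 hΓ))
  | div a c f s t, Γ, h, hΓ => by
    simp only [check, Bool.and_eq_true] at h
    obtain ⟨h1, h2⟩ := h
    split at h1
    · rename_i g hg
      simp only [Bool.and_eq_true, decide_eq_true_eq] at h1
      obtain ⟨⟨⟨⟨hc, hga⟩, hfa⟩, hz⟩, hs⟩ := h1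
      refine sound gp t _ h2 (Ctx.holds_push hΓ ?_)
      have hprod : 0 ≤ (mulAff (add g (const c)) f).eval x := by
        rw [← eval_eq_of_isZero_sub hz x]; exact Step.sound hs hΓ
      have haff : (add g (const c)).isAff = true := by
        simpa [isAff, add, const, List.isEmpty_iff] using hga
      rw [eval_mulAff x haff hfa, eval_add, eval_const] at hprod
      have hg0 : 0 ≤ g.eval x := Ctx.ineq_nonneg hΓ hg
      have hpos : 0 < g.eval x + (c : ℝ) := by
        have : (0 : ℝ) < c := by exact_mod_cast hc
        linarith
      exact nonneg_of_mul_nonneg_right hprod hpos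
    · cases h1
  | split ℓ l r, Γ, h, hΓ => by
    simp only [check, Bool.and_eq_true] at h
    rcases le_total 0 (ℓ.eval x) with hl | hl
    · exact sound gp l _ h.1 (Ctx.holds_push hΓ hl)
    · exact sound gp r _ h.2 (Ctx.holds_push hΓ (by rw [eval_neg]; linarith))
  | contra s, Γ, h, hΓ => by
    simp only [check, Bool.and_eq_true, decide_eq_true_eq] at h
    obtain ⟨⟨⟨hs, hl⟩, hq⟩, hc⟩ := h
    have h0 := Step.sound hs hΓ
    have hl' : s.target.lin = [] := List.isEmpty_iff.mp hl
    have hq' : s.target.quad = [] := List.isEmpty_iff.mp hq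
    simp only [eval, hl', hq', linEval_nil, quadEval_nil, add_zero] at h0
    have : (s.target.c : ℝ) < 0 := by exact_mod_cast hc
    linarith
  | goal spec idx, Γ, h, hΓ => by
    simp only [check] at h
    split at h
    · rename_i qs hqs
      exact ⟨spec, qs, hqs, goalsFound_sound hΓ.1 qs idx h⟩
    · cases h

end Tree

/-! ### A toy certificate (kernel smoke test)

On `{x₀ ≥ 0, x₁ ≥ 0, 1 − x₀ − x₁ ≥ 0}` the tree splits on `x₀ − x₁`; on the branch `x₀ ≥ x₁` it derives
`1 − 2x₁ ≥ 0` (`= (1 − x₀ − x₁) + (x₀ − x₁)`), on the other branch `1 − 2x₀ ≥ 0`, and reports the goal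
"`1 − 2x₁ ≥ 0` or `1 − 2x₀ ≥ 0`" (goal specifications `1` and `0`). -/

/-- Goal family of the toy: spec `k` is the single polynomial `1 − 2x_k`. [folklore] -/
def toyGoals (k : ℕ) : Option (List QPoly) := some [⟨1, [(k, -2)], []⟩]

/-- Root context of the toy. [folklore] -/
def toyCtx : Ctx := ⟨#[⟨0, [(0, 1)], []⟩, ⟨0, [(1, 1)], []⟩, ⟨1, [(0, -1), (1, -1)], []⟩], #[]⟩

/-- The toy tree. [folklore] -/
def toyTree : Tree ℕ :=
  .split ⟨0, [(0, 1), (1, -1)], []⟩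
    (.step { target := ⟨1, [(1, -2)], []⟩, lam := [(2, 1), (3, 1)] } (.goal 1 [4]))
    (.step { target := ⟨1, [(0, -2)], []⟩, lam := [(2, 1), (3, 1)] } (.goal 0 [4]))

/-- What the toy certifies, read back through `Tree.sound` (the acceptance `toyTree.check toyGoals toyCtx = true`
holds by `native_decide`; it is taken as a hypothesis here to keep this file free of the compiler axiom). [folklore] -/
example (toyTree_check : toyTree.check toyGoals toyCtx = true)
    (x : ℕ → ℝ) (h0 : 0 ≤ x 0) (h1 : 0 ≤ x 1) (h2 : x 0 + x 1 ≤ 1) : ∃ k, 0 ≤ 1 - 2 * x k := by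
  have hΓ : toyCtx.Holds x := by
    refine ⟨fun g hg => ?_, fun h hh => by simp [toyCtx] at hh⟩
    simp only [toyCtx, List.mem_toArray, List.mem_cons, List.not_mem_nil, or_false] at hg
    rcases hg with rfl | rfl | rfl <;> simp [eval, linEval, quadEval] <;> linarith
  obtain ⟨spec, qs, hs, hq⟩ := Tree.sound toyGoals toyTree toyCtx toyTree_check hΓ
  simp only [toyGoals, Option.some.injEq] at hs
  subst hs
  have := hq _ (List.mem_singleton.mpr rfl)
  refine ⟨spec, ?_⟩
  simp [eval, linEval, quadEval] at this
  linarith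

end QuadCert

/-! ### Forests: combining separately checked sub-trees (appended 2026-08-17)

A realistic certificate is checked in several compilation units.  `Certified gp Γ` is the CONCLUSION of
`Tree.sound` as a proposition; it is produced by an accepted tree (`certified_of_check`) and combined along the
top of a tree written out by hand: a case split (`certified_split`), a prefix of steps (`certified_steps`), or an
empty branch (`certified_contra`).  [folklore] -/

namespace QuadCert

variable {γ : Type}

/-- What an accepted certificate proves about a context: every real point satisfying it satisfies all goal
polynomials of some well-formed goal specification. [folklore] -/
def Certified (gp : γ → Option (List QPoly)) (Γ : Ctx) : Prop :=
  ∀ x : ℕ → ℝ, Γ.Holds x → ∃ (spec : γ) (qs : List QPoly), gp spec = some qs ∧ ∀ q ∈ qs, 0 ≤ q.eval x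

/-- An accepted tree certifies its context. [cite: Lasserre2001, Thm 4.2] -/
theorem certified_of_check {gp : γ → Option (List QPoly)} {Γ : Ctx} (t : Tree γ) (h : t.check gp Γ = true) :
    Certified gp Γ := fun _ hx => Tree.sound gp t Γ h hx

/-- Case split at the top: both signs of an affine (indeed any) polynomial certified ⇒ certified. [folklore] -/
theorem certified_split {gp : γ → Option (List QPoly)} {Γ : Ctx} (ℓ : QPoly)
    (hpos : Certified gp (Γ.push ℓ)) (hneg : Certified gp (Γ.push (neg ℓ))) : Certified gp Γ := by
  intro x hx
  rcases le_total 0 (ℓ.eval x) with hl | hl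
  · exact hpos x (Ctx.holds_push hx hl)
  · exact hneg x (Ctx.holds_push hx (by rw [eval_neg]; linarith))

/-- Run a list of steps on a context (`none` if a step is rejected). [folklore] -/
def runSteps : Ctx → List Step → Option Ctx
  | Γ, [] => some Γ
  | Γ, s :: ss => if s.ok Γ then runSteps (Γ.push s.target) ss else none

/-- Accepted steps preserve `Holds`. [folklore] -/
theorem holds_runSteps {x : ℕ → ℝ} :
    ∀ (Γ : Ctx) (ss : List Step) {Γ' : Ctx}, runSteps Γ ss = some Γ' → Γ.Holds x → Γ'.Holds x
  | Γ, [], Γ', h, hx => by simp [runSteps] at h; exact h ▸ hx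
  | Γ, s :: ss, Γ', h, hx => by
    simp only [runSteps] at h
    split_ifs at h with hs
    exact holds_runSteps _ ss h (Ctx.holds_push hx (Step.sound hs hx))

/-- A certified extension by accepted steps certifies the original context. [folklore] -/
theorem certified_steps {gp : γ → Option (List QPoly)} {Γ Γ' : Ctx} (ss : List Step)
    (h : runSteps Γ ss = some Γ') (hC : Certified gp Γ') : Certified gp Γ :=
  fun x hx => hC x (holds_runSteps Γ ss h hx)

/-- An empty context (a contradiction step is accepted) is certified. [folklore] -/
theorem certified_contra {gp : γ → Option (List QPoly)} {Γ : Ctx} (s : Step)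
    (h : (Tree.contra s : Tree γ).check gp Γ = true) : Certified gp Γ :=
  certified_of_check (Tree.contra s) h

/-- Monotonicity in the goal reading: a pointwise weaker goal family stays certified. [folklore] -/
theorem Certified.mono {gp gp' : γ → Option (List QPoly)} {Γ : Ctx}
    (hmono : ∀ spec qs, gp spec = some qs → ∃ qs', gp' spec = some qs' ∧ ∀ x : ℕ → ℝ,
      (∀ q ∈ qs, 0 ≤ q.eval x) → ∀ q ∈ qs', 0 ≤ q.eval x)
    (hC : Certified gp Γ) : Certified gp' Γ := by
  intro x hx
  obtain ⟨spec, qs, h1, h2⟩ := hC x hx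
  obtain ⟨qs', h1', h2'⟩ := hmono spec qs h1
  exact ⟨spec, qs', h1', h2' x h2⟩

end QuadCert

end Literature.Analysis.ValidatedNumerics
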